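import Summits.Ventures.DiscreteObjects.Hadamard.ElemAbelianSummary668C
import Summits.Ventures.DiscreteObjects.Hadamard.PrimeCubeOrder7
import Summits.Ventures.DiscreteObjects.Hadamard.Order49FixedTen668

/-!
# Hadamard 668 census, family F12 — the `7`-part of the signed automorphism group of an H(668) in one statement
# (kernel summary)

Framing: lottery ticket; floor = certified bounds/negative ranges.

Cell pub-namedobj (venture DiscreteObjects), target (H), hadamard gen 17.  ONE QUOTABLE STATEMENT collecting the gen-17
results at the prime `7` for a Hadamard matrix `H` of order `668` and its signed-permutation automorphisms
`(π, κ, d, e)` (`H (π i) (κ j) = d i · e j · H i j`): **`hadamard668_seven_part_summary`** —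
1. no two signed automorphisms with `7`-th powers `1`, commuting permutation parts and independent row parts
   (`⟨α, β⟩ ≅ C₇ × C₇`; `no_hadamard668_elemAbelian_rank2_7`);
2. `7³ ∤ orderOf (π, κ)` (`hadamard668_signedAut_not_dvd_orderOf_343`);
3. if `π^49 = κ^49 = 1` and `(π^7, κ^7) ≠ (1, 1)` (pair-order `49`) then `π^7`, `κ^7` fix exactly `80` rows / columns
   and `π`, `κ` exactly `10` (`hadamard668_order49_fixed_ten`) — STRUCTURE; order `49` is not excluded.
Reading (group theory on paper, see `SignedAutDictionary` for the dictionary): the Sylow `7`-subgroups of the signed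
automorphism group of any H(668) are cyclic of order dividing `49`.  Nothing here is new; ours; no `sorry`.
-/

namespace Summit.Ventures.DiscreteObjects.Hadamard

open Finset BigOperators Matrix

open Literature.Combinatorics.Designs.GoethalsSeidel (IsHadamardMatrix)

variable {ι : Type*} [Fintype ι] [DecidableEq ι]

/-- **The `7`-part of Aut± H(668), kernel summary** (see the module docstring). -/
theorem hadamard668_seven_part_summary {H : Matrix ι ι ℤ} (hH : IsHadamardMatrix H) (hι : Fintype.card ι = 668) :
    (∀ {α α' β β' : Equiv.Perm ι} {d₁ e₁ d₂ e₂ : ι → ℤ},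
      IsSignedAut H α α' d₁ e₁ → IsSignedAut H β β' d₂ e₂ → α ^ 7 = 1 → α' ^ 7 = 1 → β ^ 7 = 1 → β' ^ 7 = 1 →
      Commute α β → Commute α' β' → (∀ a b : ℕ, a < 7 → b < 7 → α ^ a * β ^ b = 1 → a = 0 ∧ b = 0) → False) ∧
    (∀ (π κ : Equiv.Perm ι) (d e : ι → ℤ), IsSignedAut H π κ d e →
      ¬ 7 ^ 3 ∣ orderOf ((π, κ) : Equiv.Perm ι × Equiv.Perm ι)) ∧
    (∀ (π κ : Equiv.Perm ι) (d e : ι → ℤ), IsSignedAut H π κ d e → π ^ 49 = 1 → κ ^ 49 = 1 →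
      (π ^ 7 ≠ 1 ∨ κ ^ 7 ≠ 1) →
      (univ.filter fun i => (π ^ 7) i = i).card = 80 ∧ (univ.filter fun j => (κ ^ 7) j = j).card = 80 ∧
      (univ.filter fun i => π i = i).card = 10 ∧ (univ.filter fun j => κ j = j).card = 10) := by
  refine ⟨?_, ?_, ?_⟩
  · intro α α' β β' d₁ e₁ d₂ e₂ hA hB hα hα' hβ hβ' hc hc' hind
    exact no_hadamard668_elemAbelian_rank2_7 hH hι hA hB hα hα' hβ hβ' hc hc' hind
  · intro π κ d e haut hdvd
    exact hadamard668_signedAut_not_dvd_orderOf_343 hH hι π κ d e haut hdvd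
  · intro π κ d e haut hπ hκ hne
    exact hadamard668_order49_fixed_ten hH hι π κ d e haut hπ hκ hne

end Summit.Ventures.DiscreteObjects.Hadamard
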